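import Literature.Analysis.Complex.BacklundJensenAverage
import HarnessLib

/-!
# Backlund's trick: half of Backlund's lemma from an approximate reflection symmetry

Trunk T-ANALYSIS support (`Literature/Analysis/Complex`), companion of `BacklundArgVariation.lean`
(Backlund's lemma `|Im ∫_a^b g'/g| ≤ π(log(M/|g(c+iy)|)/log(R/r) + 1)`) and
`BacklundJensenAverage.lean` (the same with the circle *average* and without the `+1`).  Everything
here is PROVED; there are no named facts and no definitions.

**Backlund's trick** (Backlund 1918, for `ζ`; in the explicit literature: McCurley 1984,
Trudgian 2014, Bennett–Martin–O'Bryant–Rechnitzer 2021 (Prop. 5.4), Hasanalizade–Shen–Wong 2022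
(Prop. 3.2 of the `ζ` paper = Prop. 3.7 of the Dedekind paper)) halves the constant in Backlund's
lemma when the function has a reflection symmetry about the left end-point `x₀` of the segment:
the zeros of `Re (e g)^N` on the segment, which measure the variation of `arg g`, then come in pairs
`x₀ ± d` (up to a bounded number), and in Jensen's formula on the disc `|z - c| ≤ R`,
`c = x₀ + ρ`, a pair weighs `log (R²/((ρ-d)(ρ+d))) ≥ 2 log(R/ρ)` instead of `log(R/ρ)`.  For `ζ`
the symmetry is the functional equation (`x₀ = ½`), exact for `ξ` and approximate for
`(s-1)ζ(s)` up to the variation `E(T,δ)` of the argument of the `Γ`-factor.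

## Main results

* `Literature.Analysis.Complex.sum_log_div_le_circleAverage_sub` — Jensen's inequality with
  weights: for a finite set `F` of zeros of an analytic `f` in `|u - c| < R`,
  `Σ_{u ∈ F} log(R/|u-c|) ≤ circleAverage (log |f|) c R - log |f c|`.
* `Literature.Analysis.Complex.eq_mul_exp_integral_logDeriv(')`,
  `Literature.Analysis.Complex.re_eq_zero_of_im_integral_logDeriv_eq` — `h(v+iy) = h(u+iy) exp ∫_u^v h'/h`
  along a zero-free horizontal segment; hence, if `h(c+iy) > 0`, every point where the argument
  `Im ∫_c^x h'/h` is `≡ π/2 (mod π)` is a zero of `Re h`.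
* `Literature.Analysis.Complex.backlund_pairing_sum_ge` — the combinatorial core, for a real
  continuous "argument" `ψ` with `|ψ(a+d) + ψ(a-d) - 2ψ(a)| ≤ ε` (`0 ≤ d ≤ δ`): a weighted count of
  the lattice hits `ψ ∈ α + πℤ` on `[a-δ, b]` is at least `(2(ψ b - ψ a)/π - ε/π - 4) ℓ` when hits
  in `[a+δ, b]` weigh `≥ 2ℓ`, hits in `(a, a+δ)` weigh `≥ ℓ`, and a hit at `a + d` together with
  any point of `[a-d, a]` weighs `≥ 2ℓ` ([BMOR21, proof of Prop. 5.4]).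
* `Literature.Analysis.Complex.abs_im_integral_logDeriv_le_backlundTrick` — **Backlund's trick**:
  `g` analytic on `|z - (c+iy)| ≤ R`, `g(c+iy) ≠ 0`, `0 < ρ < R`, `σ₁ = c + ρ²/R`,
  `δ = ρ - ρ²/R`, `g ≠ 0` on `[c-ρ-δ, σ₁] × {y}`, a majorant `B ≥ 1` of `|g(z+iy)|`, `|g(z̄+iy)|`
  on `|z-c| = R` with `circleAverage (log B) c R ≤ A`, and
  `|Im ∫_{c-ρ}^{c-ρ+d} g'/g + Im ∫_{c-ρ}^{c-ρ-d} g'/g| ≤ ε` for `0 ≤ d ≤ δ` give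
  `|Im ∫_{c-ρ}^{σ₁} g'/g (x+iy) dx| ≤ π (A - log|g(c+iy)|)/(2 log(R/ρ)) + ε/2`.
  (The sources carry `+ E/2 + π/m` resp. `+ E/2 + π/N + π/(2N) + π/4`; here `N → ∞` is taken
  inside, and the `π/4` of [HSW22], which bounds the arctangent part of their `E` by `π/2`, is
  left to the user as part of `ε`.)

## References

* R. J. Backlund, *Über die Nullstellen der Riemannschen Zetafunktion*, Acta Math. 41 (1918),
  345–375, §3.
* M. A. Bennett, G. Martin, K. O'Bryant, A. Rechnitzer, *Counting zeros of Dirichlet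
  `L`-functions*, Math. Comp. 90 (2021), 1455–1482 = arXiv:2005.02989, Lemma 5.3, Prop. 5.4.
  [BMOR21]
* E. Hasanalizade, Q. Shen, P.-J. Wong, *Counting zeros of the Riemann zeta function*, J. Number
  Theory 235 (2022), 219–241, Props. 3.1–3.2. [cite: HasanalizadeShenWong2022, Prop. 3.2]
* E. Hasanalizade, Q. Shen, P.-J. Wong, *Counting zeros of Dedekind zeta functions*, Math. Comp.
  91 (2022), 277–293 = arXiv:2102.04663, Lemma 3.2, Lemma 3.6, Props. 3.5, 3.7.
* E. C. Titchmarsh, *The Theory of the Riemann Zeta-Function*, 2nd ed. (1986), §9.4.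
  [cite: Titchmarsh1986, §9.4]
-/

noncomputable section

open Complex Set MeasureTheory Filter Topology intervalIntegral Metric MeromorphicOn
open scoped Real ComplexConjugate

namespace Literature.Analysis.Complex

/-! ### Jensen's formula with weights: a finite set of zeros -/

/-- **Jensen's inequality, weighted form.** If `f` is analytic on `|z - c| ≤ R`, `f c ≠ 0`, and
`F` is a finite set of zeros of `f` with `‖u - c‖ < R`, then
`∑_{u ∈ F} log(R/‖u - c‖) ≤ circleAverage (log ‖f‖) c R - log ‖f c‖`
(Jensen's formula: the average equals `log‖f c‖ + Σ_{|u-c| ≤ R} mult(u) log(R/|u-c|)`, every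
multiplicity of a zero is `≥ 1`, and all terms are non-negative). [cite: Titchmarsh1986, §9.4] -/
theorem sum_log_div_le_circleAverage_sub {c : ℂ} {R : ℝ} {f : ℂ → ℂ} (hR : 0 < R)
    (hf : AnalyticOnNhd ℂ f (closedBall c R)) (hfc : f c ≠ 0)
    (F : Finset ℂ) (hF : ∀ u ∈ F, ‖u - c‖ < R ∧ f u = 0) :
    ∑ u ∈ F, Real.log (R / ‖u - c‖) ≤
      Real.circleAverage (fun z ↦ Real.log ‖f z‖) c R - Real.log ‖f c‖ := by
  have hf' : AnalyticOnNhd ℂ f (closedBall c |R|) := by rwa [abs_of_pos hR]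
  have jensen := hf'.circleAverage_log_norm hR.ne' hfc
  set U := closedBall c |R| with hU
  set D := MeromorphicOn.divisor f U with hD
  have hmer : MeromorphicOn f U := hf'.meromorphicOn
  have hfin : (Function.support fun u ↦ (D u : ℝ) * Real.log (R * ‖c - u‖⁻¹)).Finite := by
    refine (D.finiteSupport (isCompact_closedBall _ _)).subset fun u hu ↦ ?_
    rw [Function.mem_support] at hu ⊢
    intro h; exact hu (by rw [h]; simp)
  rw [jensen, add_sub_cancel_right, finsum_eq_sum_of_support_subset _ (s := hfin.toFinset) (by simp)]
  -- every point of `F` carries divisor `≥ 1`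
  have hDu : ∀ u ∈ F, (1 : ℝ) ≤ D u := by
    intro u hu
    obtain ⟨huR, hu0⟩ := hF u hu
    have huU : u ∈ U := by
      rw [hU, mem_closedBall, dist_eq_norm, abs_of_pos hR]; exact huR.le
    rw [hD, MeromorphicOn.divisor_apply hmer huU]
    have han : AnalyticAt ℂ f u := hf' u huU
    have hne_top : analyticOrderAt f u ≠ ⊤ := by
      intro htop
      rw [analyticOrderAt_eq_top] at htop
      have hpre : IsPreconnected U := (convex_closedBall c |R|).isPreconnected
      have hcU : c ∈ U := mem_closedBall_self (abs_nonneg R)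
      exact hfc (hf'.eqOn_zero_of_preconnected_of_eventuallyEq_zero hpre huU htop hcU)
    have hpos : 0 < analyticOrderAt f u := by
      rw [pos_iff_ne_zero, Ne, han.analyticOrderAt_eq_zero]
      exact not_not.2 hu0
    obtain ⟨n, hn⟩ := ENat.ne_top_iff_exists.mp hne_top
    rw [← hn] at hpos
    have hn1 : 1 ≤ n := Nat.one_le_iff_ne_zero.2 (by rintro rfl; simp at hpos)
    rw [han.meromorphicOrderAt_eq, ← hn, ENat.map_coe, WithTop.untop₀_coe]
    exact_mod_cast hn1
  -- the weights are non-negative on `F` and all the terms of Jensen's sum are non-negative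
  have hwF : ∀ u ∈ F, 0 ≤ Real.log (R / ‖u - c‖) := by
    intro u hu
    obtain ⟨huR, -⟩ := hF u hu
    rcases (norm_nonneg (u - c)).eq_or_lt with h0 | hpos
    · rw [← h0, div_zero, Real.log_zero]
    · exact Real.log_nonneg ((one_le_div hpos).2 huR.le)
  have hterm : ∀ u, 0 ≤ (D u : ℝ) * Real.log (R * ‖c - u‖⁻¹) := by
    intro u
    have h0 : (0 : ℤ) ≤ D u := by simpa using hf'.divisor_nonneg u
    by_cases huU : u ∈ U
    · refine mul_nonneg (by exact_mod_cast h0) ?_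
      rcases (norm_nonneg (c - u)).eq_or_lt with h1 | hpos
      · rw [← h1, inv_zero, mul_zero, Real.log_zero]
      · refine Real.log_nonneg ?_
        rw [mem_closedBall, dist_eq_norm', abs_of_pos hR] at huU
        rw [le_mul_inv_iff₀ hpos, one_mul]; exact huU
    · simp [hD, Function.locallyFinsuppWithin.apply_eq_zero_of_notMem _ huU]
  calc ∑ u ∈ F, Real.log (R / ‖u - c‖)
      ≤ ∑ u ∈ F, (D u : ℝ) * Real.log (R * ‖c - u‖⁻¹) := by
        refine Finset.sum_le_sum fun u hu ↦ ?_
        rw [norm_sub_rev, div_eq_mul_inv]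
        have h1 := hDu u hu
        have h2 : 0 ≤ Real.log (R * ‖c - u‖⁻¹) := by
          have := hwF u hu; rwa [norm_sub_rev, div_eq_mul_inv] at this
        nlinarith
    _ = ∑ u ∈ F with (D u : ℝ) * Real.log (R * ‖c - u‖⁻¹) ≠ 0,
          (D u : ℝ) * Real.log (R * ‖c - u‖⁻¹) := (Finset.sum_filter_ne_zero _).symm
    _ ≤ ∑ u ∈ hfin.toFinset, (D u : ℝ) * Real.log (R * ‖c - u‖⁻¹) := by
        refine Finset.sum_le_sum_of_subset_of_nonneg (fun u hu ↦ ?_) (fun u _ _ ↦ hterm u)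
        rw [Finset.mem_filter] at hu
        rw [Set.Finite.mem_toFinset, Function.mem_support]
        exact hu.2

/-! ### The logarithmic derivative integrates to the quotient -/

/-- If `h` is analytic and non-zero at every point of the horizontal segment `[u,v] × {y}`, then
`h(v+iy) = h(u+iy) · exp(∫_u^v h'/h (x+iy) dx)`. [folklore] -/
theorem eq_mul_exp_integral_logDeriv {h : ℂ → ℂ} {y u v : ℝ} (huv : u ≤ v)
    (hh : ∀ x ∈ Icc u v, AnalyticAt ℂ h (x + y * I)) (h0 : ∀ x ∈ Icc u v, h (x + y * I) ≠ 0) :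
    h (v + y * I) = h (u + y * I) *
      Complex.exp (∫ x : ℝ in u..v, deriv h (x + y * I) / h (x + y * I)) := by
  set f : ℝ → ℂ := fun x ↦ deriv h (x + y * I) / h (x + y * I) with hf
  -- `f` is continuous on `[u, v]`
  have hfc : ContinuousOn f (Icc u v) := by
    intro x hx
    have han := hh x hx
    have hline : ContinuousAt (fun x : ℝ ↦ (x : ℂ) + y * I) x :=
      (Complex.continuous_ofReal.add continuous_const).continuousAt
    have h1 : ContinuousAt (fun x : ℝ ↦ deriv h (x + y * I)) x :=
      ContinuousAt.comp (f := fun x : ℝ ↦ (x : ℂ) + y * I) han.deriv.continuousAt hline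
    have h2 : ContinuousAt (fun x : ℝ ↦ h (x + y * I)) x :=
      ContinuousAt.comp (f := fun x : ℝ ↦ (x : ℂ) + y * I) han.continuousAt hline
    exact (h1.div h2 (h0 x hx)).continuousWithinAt
  have hfi : ∀ x ∈ Icc u v, IntervalIntegrable f volume u x := fun x hx ↦
    (hfc.mono (Icc_subset_Icc_right hx.2)).intervalIntegrable_of_Icc hx.1
  set Φ : ℝ → ℂ := fun x ↦ h (x + y * I) * Complex.exp (-∫ s in u..x, f s) with hΦ
  -- `Φ` is continuous on `[u, v]`
  have hIc : ContinuousOn (fun x ↦ ∫ s in u..x, f s) (Icc u v) := by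
    have hio : IntegrableOn f (uIcc u v) volume := by
      rw [uIcc_of_le huv]; exact hfc.integrableOn_compact isCompact_Icc
    have := intervalIntegral.continuousOn_primitive_interval (μ := volume) hio
    rwa [uIcc_of_le huv] at this
  have hΦc : ContinuousOn Φ (Icc u v) := by
    refine ContinuousOn.mul ?_ (hIc.neg.cexp)
    intro x hx
    have hline : ContinuousAt (fun x : ℝ ↦ (x : ℂ) + y * I) x :=
      (Complex.continuous_ofReal.add continuous_const).continuousAt
    exact (ContinuousAt.comp (f := fun x : ℝ ↦ (x : ℂ) + y * I) (hh x hx).continuousAt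
      hline).continuousWithinAt
  -- `Φ' = 0` in the interior
  have hΦd : ∀ x ∈ Ioo u v, HasDerivWithinAt Φ 0 (Ioi x) x := by
    intro x hx
    have hxI : x ∈ Icc u v := Ioo_subset_Icc_self hx
    have han := hh x hxI
    -- derivative of the primitive
    have hId : HasDerivAt (fun x ↦ ∫ s in u..x, f s) (f x) x := by
      refine intervalIntegral.integral_hasDerivAt_right (hfi x hxI) ?_ ?_
      · exact (hfc.mono Ioo_subset_Icc_self).stronglyMeasurableAtFilter isOpen_Ioo x hx
      · exact (hfc.mono Ioo_subset_Icc_self).continuousAt (Ioo_mem_nhds hx.1 hx.2)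
    -- derivative of `x ↦ h(x+iy)`
    have hhd : HasDerivAt (fun x : ℝ ↦ h (x + y * I)) (deriv h (x + y * I)) x := by
      have h1 : HasDerivAt (fun w : ℂ ↦ w + y * I) 1 (x : ℂ) := (hasDerivAt_id (x : ℂ)).add_const _
      have h2 : HasDerivAt (fun w : ℂ ↦ h (w + y * I)) (deriv h (x + y * I) * 1) (x : ℂ) :=
        han.differentiableAt.hasDerivAt.comp (x : ℂ) h1
      simpa using h2.comp_ofReal
    have hexp : HasDerivAt (fun x ↦ Complex.exp (-∫ s in u..x, f s))
        (Complex.exp (-∫ s in u..x, f s) * (-f x)) x := hId.neg.cexp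
    have hprod := hhd.mul hexp
    have hzero : deriv h (x + y * I) * Complex.exp (-∫ s in u..x, f s) +
        h (x + y * I) * (Complex.exp (-∫ s in u..x, f s) * (-f x)) = 0 := by
      have hne := h0 x hxI
      rw [hf]
      field_simp
      ring
    rw [hzero] at hprod
    exact hprod.hasDerivWithinAt
  -- hence `Φ v = Φ u`
  have hint := intervalIntegral.integral_eq_sub_of_hasDeriv_right_of_le huv hΦc hΦd
    (by simp)
  simp only [intervalIntegral.integral_zero] at hint
  have hΦuv : Φ v = Φ u := sub_eq_zero.1 hint.symm
  have hΦu : Φ u = h (u + y * I) := by simp [hΦ]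
  rw [hΦu] at hΦuv
  -- unfold
  have : h (v + y * I) * Complex.exp (-∫ s in u..v, f s) = h (u + y * I) := hΦuv
  calc h (v + y * I)
      = h (v + y * I) * Complex.exp (-∫ s in u..v, f s) * Complex.exp (∫ s in u..v, f s) := by
        rw [mul_assoc, ← Complex.exp_add, neg_add_cancel, Complex.exp_zero, mul_one]
    _ = h (u + y * I) * Complex.exp (∫ s in u..v, f s) := by rw [this]


/-- Symmetric form of `eq_mul_exp_integral_logDeriv`: for any two points `p, q` of a segment on
which `h` is analytic and non-zero, `h(q+iy) = h(p+iy) · exp(∫_p^q h'/h (x+iy) dx)`. [folklore] -/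
theorem eq_mul_exp_integral_logDeriv' {h : ℂ → ℂ} {y u v p q : ℝ}
    (hh : ∀ x ∈ Icc u v, AnalyticAt ℂ h (x + y * I)) (h0 : ∀ x ∈ Icc u v, h (x + y * I) ≠ 0)
    (hp : p ∈ Icc u v) (hq : q ∈ Icc u v) :
    h (q + y * I) = h (p + y * I) *
      Complex.exp (∫ x : ℝ in p..q, deriv h (x + y * I) / h (x + y * I)) := by
  rcases le_total p q with hpq | hqp
  · have hsub : Icc p q ⊆ Icc u v := Icc_subset_Icc hp.1 hq.2
    exact eq_mul_exp_integral_logDeriv hpq (fun x hx ↦ hh x (hsub hx)) (fun x hx ↦ h0 x (hsub hx))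
  · have hsub : Icc q p ⊆ Icc u v := Icc_subset_Icc hq.1 hp.2
    have e := eq_mul_exp_integral_logDeriv hqp (fun x hx ↦ hh x (hsub hx)) (fun x hx ↦ h0 x (hsub hx))
    rw [intervalIntegral.integral_symm, Complex.exp_neg, e, mul_assoc, ← Complex.exp_neg,
      ← Complex.exp_add, add_neg_cancel, Complex.exp_zero, mul_one]

/-- **Lattice values of the argument are zeros of the real part.** If `h` is analytic and non-zero on
the segment `[u,v] × {y}`, `h(c+iy)` is real and positive for some `c ∈ [u,v]`, and at `x ∈ [u,v]` the
variation of the argument `Im ∫_c^x h'/h` equals `π/2 + kπ` for an integer `k`, then `Re h(x+iy) = 0`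
(`h(x+iy) = h(c+iy) e^{Re ∫ + i Im ∫}`). [cite: Titchmarsh1986, §9.4] -/
theorem re_eq_zero_of_im_integral_logDeriv_eq {h : ℂ → ℂ} {y u v c x : ℝ}
    (hh : ∀ x ∈ Icc u v, AnalyticAt ℂ h (x + y * I)) (h0 : ∀ x ∈ Icc u v, h (x + y * I) ≠ 0)
    (hc : c ∈ Icc u v) (hx : x ∈ Icc u v) (hcim : (h (c + y * I)).im = 0)
    (k : ℤ) (hk : (∫ s : ℝ in c..x, deriv h (s + y * I) / h (s + y * I)).im = π / 2 + k * π) :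
    (h (x + y * I)).re = 0 := by
  set J := ∫ s : ℝ in c..x, deriv h (s + y * I) / h (s + y * I) with hJ
  have e := eq_mul_exp_integral_logDeriv' hh h0 hc hx
  have hreal : h (c + y * I) = ((h (c + y * I)).re : ℂ) := by
    apply Complex.ext <;> simp [hcim]
  rw [e, hreal, Complex.re_ofReal_mul, Complex.exp_re, hk]
  have : Real.cos (π / 2 + k * π) = 0 := by
    rw [Real.cos_eq_zero_iff]
    exact ⟨k, by ring⟩
  rw [this]; ring

/-! ### The pairing argument (Backlund's trick), real-variable form -/

/-- **Backlund's pairing count** (the combinatorial core of Backlund's trick, [BMOR20, Prop. 5.4],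
[HSW-Dedekind, Prop. 3.7]). Let `ψ` be continuous on `[a-δ, b]` ("the argument of `h` along the
segment") with the approximate reflection symmetry `|ψ(a+d) + ψ(a-d) - 2ψ(a)| ≤ ε` for `0 ≤ d ≤ δ`, and
call `x` a hit if `ψ x ∈ α + πℤ`. Suppose the finite set `F` contains all hits of `[a-δ, b]` and carries
non-negative weights `w` with `w ≥ 2ℓ` on `[a+δ, b]`, `w ≥ ℓ` on `(a, a+δ)`, and
`w x + w x' ≥ 2ℓ` whenever `a < x < a+δ` and `2a - x ≤ x' ≤ a`. Then
`Σ_{x ∈ F} w x ≥ (2(ψ b - ψ a)/π - ε/π - 4) ℓ`: the `m ≥ (ψ b - ψ a)/π - 1` lattice values above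
`ψ a` are hit at distinct points of `(a, b]`; a hit at `a + d`, `d < δ`, beyond the first `⌈ε/π⌉ + 1`
forces (reflection + intermediate values) a distinct hit in `[a-d, a]`, its pair.
[cite: HasanalizadeShenWong2022, Prop. 3.2] -/
theorem backlund_pairing_sum_ge {ψ w : ℝ → ℝ} {a b δ ℓ ε α : ℝ} (hab : a ≤ b) (hδ : 0 < δ)
    (hℓ : 0 < ℓ) (hε : 0 ≤ ε) (hψ : ContinuousOn ψ (Icc (a - δ) b))
    (hrefl : ∀ d ∈ Icc (0 : ℝ) δ, |ψ (a + d) + ψ (a - d) - 2 * ψ a| ≤ ε)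
    (F : Finset ℝ) (hF : ∀ x ∈ Icc (a - δ) b, (∃ k : ℤ, ψ x = α + k * π) → x ∈ F)
    (hw0 : ∀ x ∈ F, 0 ≤ w x)
    (hw2 : ∀ x ∈ F, a + δ ≤ x → x ≤ b → 2 * ℓ ≤ w x)
    (hw1 : ∀ x ∈ F, a < x → x < a + δ → ℓ ≤ w x)
    (hwp : ∀ x ∈ F, ∀ x' ∈ F, a < x → x < a + δ → 2 * a - x ≤ x' → x' ≤ a → 2 * ℓ ≤ w x + w x') :
    (2 * (ψ b - ψ a) / π - ε / π - 4) * ℓ ≤ ∑ x ∈ F, w x := by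
  have hπ := Real.pi_pos
  have hsum0 : 0 ≤ ∑ x ∈ F, w x := Finset.sum_nonneg hw0
  set V := ψ b - ψ a with hV
  by_cases hsmall : 2 * V / π - ε / π - 4 ≤ 0
  · exact le_trans (mul_nonpos_of_nonpos_of_nonneg hsmall hℓ.le) hsum0
  push Not at hsmall
  have hVpos : 0 < V := by
    have h1 : 0 ≤ ε / π := div_nonneg hε hπ.le
    have h2 : 0 < 2 * V / π := by linarith
    have := (div_pos_iff_of_pos_right hπ).1 h2
    linarith
  -- the number of lattice values in `(ψ a, ψ a + V]`
  set m : ℕ := ⌊V / π⌋₊ with hm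
  have hm1 : (m : ℝ) ≤ V / π := Nat.floor_le (div_nonneg hVpos.le hπ.le)
  have hm2 : V / π < m + 1 := Nat.lt_floor_add_one _
  -- the first lattice value above `ψ a`
  set k₀ : ℤ := ⌊(ψ a - α) / π⌋ with hk₀
  set y : ℕ → ℝ := fun j ↦ α + ((k₀ : ℝ) + 1 + j) * π with hy
  have hy0a : ψ a < y 0 := by
    have h1 : (ψ a - α) / π < k₀ + 1 := Int.lt_floor_add_one _
    rw [div_lt_iff₀ hπ] at h1
    simp only [hy, Nat.cast_zero, add_zero]
    linarith
  have hy0b : y 0 ≤ ψ a + π := by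
    have h1 : (k₀ : ℝ) ≤ (ψ a - α) / π := Int.floor_le _
    rw [le_div_iff₀ hπ] at h1
    simp only [hy, Nat.cast_zero, add_zero]
    linarith
  have hyj : ∀ j : ℕ, y j = y 0 + j * π := by intro j; simp only [hy, Nat.cast_zero]; ring
  -- right hits
  have hexσ : ∀ j : ℕ, j < m → ∃ σ ∈ Icc a b, ψ σ = y j := by
    intro j hj
    have hj' : (j : ℝ) + 1 ≤ m := by exact_mod_cast hj
    have h1 : y j ≤ ψ b := by
      rw [hyj]
      have : ((m : ℝ)) * π ≤ V := by rwa [le_div_iff₀ hπ] at hm1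
      nlinarith
    have h2 : ψ a ≤ y j := by rw [hyj]; nlinarith [hy0a]
    have hcont : ContinuousOn ψ (Icc a b) := hψ.mono (Icc_subset_Icc (by linarith) le_rfl)
    obtain ⟨σ, hσ, hσy⟩ := intermediate_value_Icc hab hcont ⟨h2, h1⟩
    exact ⟨σ, hσ, hσy⟩
  choose! σ hσI hσy using hexσ
  have hσa : ∀ j, j < m → a < σ j := by
    intro j hj
    rcases (hσI j hj).1.eq_or_lt with h | h
    · exfalso
      have := hσy j hj
      rw [← h, hyj] at this
      nlinarith [hy0a, (Nat.cast_nonneg j : (0 : ℝ) ≤ j)]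
    · exact h
  have hσF : ∀ j, j < m → σ j ∈ F := fun j hj ↦
    hF (σ j) ⟨by linarith [(hσI j hj).1], (hσI j hj).2⟩ ⟨k₀ + 1 + j, by rw [hσy j hj]; push_cast; rfl⟩
  -- the shift `p`
  set p : ℕ := ⌈ε / π⌉₊ + 1 with hp
  have hp1 : ε ≤ ((p : ℝ) - 1) * π := by
    have h1 : ε / π ≤ ⌈ε / π⌉₊ := Nat.le_ceil _
    rw [div_le_iff₀ hπ] at h1
    simp only [hp, Nat.cast_add, Nat.cast_one, add_sub_cancel_right]
    exact h1
  have hp2 : (p : ℝ) ≤ ε / π + 2 := by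
    have h1 : (⌈ε / π⌉₊ : ℝ) < ε / π + 1 := Nat.ceil_lt_add_one (div_nonneg hε hπ.le)
    simp only [hp, Nat.cast_add, Nat.cast_one]
    linarith
  -- left lattice values
  set v : ℕ → ℝ := fun i ↦ y 0 - ((i : ℝ) + 1) * π with hv
  -- the paired indices and their partners
  have hexτ : ∀ j : ℕ, j < m → p ≤ j → σ j < a + δ →
      ∃ τ ∈ Icc (2 * a - σ j) a, ψ τ = v (j - p) := by
    intro j hj hpj hσδ
    set d := σ j - a with hd
    have hd0 : 0 < d := by have := hσa j hj; linarith
    have hdδ : d ≤ δ := by linarith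
    have hr := hrefl d ⟨hd0.le, hdδ⟩
    rw [abs_le] at hr
    have had : a + d = σ j := by rw [hd]; ring
    rw [had, hσy j hj, hyj] at hr
    have hjp : (((j - p : ℕ) : ℝ)) = j - p := by rw [Nat.cast_sub hpj]
    -- `ψ (a - d) ≤ v (j - p) ≤ ψ a`
    have h1 : ψ (a - d) ≤ v (j - p) := by
      simp only [hv, hjp]
      nlinarith [hr.2, hp1, hy0a]
    have h2 : v (j - p) ≤ ψ a := by
      simp only [hv, hjp]
      have : (0 : ℝ) ≤ (j : ℝ) - p := by rw [← hjp]; exact Nat.cast_nonneg _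
      nlinarith [hy0b]
    have hcont : ContinuousOn ψ (Icc (a - d) a) :=
      hψ.mono (Icc_subset_Icc (by linarith) (by linarith))
    obtain ⟨τ, hτ, hτv⟩ := intermediate_value_Icc (by linarith) hcont ⟨h1, h2⟩
    refine ⟨τ, ⟨?_, hτ.2⟩, hτv⟩
    have := hτ.1; rw [hd] at this; linarith
  choose! τ hτI hτv using hexτ
  -- the index sets
  set P : Finset ℕ := (Finset.range m).filter (fun j ↦ p ≤ j ∧ σ j < a + δ) with hP
  set Pc : Finset ℕ := (Finset.range m).filter (fun j ↦ ¬ (p ≤ j ∧ σ j < a + δ)) with hPc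
  have hPmem : ∀ j ∈ P, j < m ∧ p ≤ j ∧ σ j < a + δ := fun j hj ↦ by
    simpa [hP, Finset.mem_filter, Finset.mem_range] using hj
  have hτF : ∀ j ∈ P, τ j ∈ F := by
    intro j hj
    obtain ⟨hjm, hpj, hσδ⟩ := hPmem j hj
    obtain ⟨hτ1, hτ2⟩ := hτI j hjm hpj hσδ
    refine hF (τ j) ⟨by linarith, by linarith⟩ ⟨k₀ - ((j - p : ℕ) : ℤ), ?_⟩
    rw [hτv j hjm hpj hσδ]
    simp only [hv, hy]
    push_cast
    ring
  -- injectivity and disjointness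
  have hinjσ : Set.InjOn σ (Finset.range m : Set ℕ) := by
    intro j hj j' hj' hjj
    simp only [Finset.coe_range, mem_Iio] at hj hj'
    have h1 : y j = y j' := by rw [← hσy j hj, ← hσy j' hj', hjj]
    have e1 := hyj j
    have e2 := hyj j'
    have : (j' : ℝ) = j := by
      have h2 : ((j' : ℝ) - j) * π = 0 := by linarith
      rcases mul_eq_zero.1 h2 with h3 | h3
      · linarith
      · exact absurd h3 hπ.ne'
    exact_mod_cast this.symm
  have hinjτ : Set.InjOn τ (P : Set ℕ) := by
    intro j hj j' hj' hjj
    obtain ⟨hjm, hpj, hσδ⟩ := hPmem j hj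
    obtain ⟨hjm', hpj', hσδ'⟩ := hPmem j' hj'
    have h1 := hτv j hjm hpj hσδ
    rw [hjj, hτv j' hjm' hpj' hσδ'] at h1
    simp only [hv] at h1
    have h2 : (((j' - p : ℕ) : ℝ)) = ((j - p : ℕ) : ℝ) := by
      have h3 : ((((j' - p : ℕ) : ℝ)) - ((j - p : ℕ) : ℝ)) * π = 0 := by linarith
      rcases mul_eq_zero.1 h3 with h4 | h4
      · linarith
      · exact absurd h4 hπ.ne'
    have h3 : j' - p = j - p := by exact_mod_cast h2
    omega
  have hdisj : Disjoint ((Finset.range m).image σ) (P.image τ) := by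
    rw [Finset.disjoint_left]
    intro x hx hx'
    rw [Finset.mem_image] at hx hx'
    obtain ⟨j, hj, rfl⟩ := hx
    obtain ⟨j', hj', hjj⟩ := hx'
    rw [Finset.mem_range] at hj
    obtain ⟨hjm', hpj', hσδ'⟩ := hPmem j' hj'
    have h1 := (hτI j' hjm' hpj' hσδ').2
    have h2 := hσa j hj
    rw [hjj] at h1
    linarith
  -- the sub-sum over the chosen hits
  have hsub : (Finset.range m).image σ ∪ P.image τ ⊆ F := by
    intro x hx
    rw [Finset.mem_union, Finset.mem_image, Finset.mem_image] at hx
    rcases hx with ⟨j, hj, rfl⟩ | ⟨j, hj, rfl⟩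
    · exact hσF j (Finset.mem_range.1 hj)
    · exact hτF j hj
  have hstep1 : ∑ j ∈ Finset.range m, w (σ j) + ∑ j ∈ P, w (τ j) ≤ ∑ x ∈ F, w x := by
    rw [← Finset.sum_image hinjσ, ← Finset.sum_image hinjτ, ← Finset.sum_union hdisj]
    exact Finset.sum_le_sum_of_subset_of_nonneg hsub fun x hx _ ↦ hw0 x hx
  -- split the right hits into paired and unpaired ones
  have hsplit : ∑ j ∈ Finset.range m, w (σ j) = ∑ j ∈ P, w (σ j) + ∑ j ∈ Pc, w (σ j) :=
    (Finset.sum_filter_add_sum_filter_not _ _ _).symm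
  have hcard : (P.card : ℝ) + Pc.card = m := by
    have := Finset.card_filter_add_card_filter_not (s := Finset.range m)
      (p := fun j ↦ p ≤ j ∧ σ j < a + δ)
    rw [Finset.card_range] at this
    exact_mod_cast this
  -- paired: each pair weighs at least `2ℓ`
  have hpaired : 2 * ℓ * P.card ≤ ∑ j ∈ P, (w (σ j) + w (τ j)) := by
    have : ∑ j ∈ P, (w (σ j) + w (τ j)) ≥ ∑ j ∈ P, 2 * ℓ := by
      refine Finset.sum_le_sum fun j hj ↦ ?_
      obtain ⟨hjm, hpj, hσδ⟩ := hPmem j hj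
      obtain ⟨hτ1, hτ2⟩ := hτI j hjm hpj hσδ
      exact hwp (σ j) (hσF j hjm) (τ j) (hτF j hj) (hσa j hjm) hσδ hτ1 hτ2
    simpa [mul_comm] using this
  -- unpaired: at least `2ℓ`, except for at most `p` of them which weigh at least `ℓ`
  have hunpaired : 2 * ℓ * Pc.card - ℓ * p ≤ ∑ j ∈ Pc, w (σ j) := by
    have hterm : ∀ j ∈ Pc, 2 * ℓ - (if j < p then ℓ else 0) ≤ w (σ j) := by
      intro j hj
      simp only [hPc, Finset.mem_filter, Finset.mem_range, not_and, not_lt] at hj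
      obtain ⟨hjm, hj⟩ := hj
      by_cases hσδ : σ j < a + δ
      · have hjp : j < p := by
          by_contra hh; push Not at hh; exact absurd (hj hh) (not_le.2 hσδ)
        rw [if_pos hjp]
        have := hw1 (σ j) (hσF j hjm) (hσa j hjm) hσδ
        linarith
      · push Not at hσδ
        have := hw2 (σ j) (hσF j hjm) hσδ (hσI j hjm).2
        split_ifs <;> linarith
    have h1 : ∑ j ∈ Pc, (2 * ℓ - (if j < p then ℓ else 0)) ≤ ∑ j ∈ Pc, w (σ j) :=
      Finset.sum_le_sum hterm
    have h2 : ∑ j ∈ Pc, (if j < p then ℓ else 0) ≤ ℓ * p := by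
      calc ∑ j ∈ Pc, (if j < p then ℓ else 0)
          ≤ ∑ j ∈ Finset.range m, (if j < p then ℓ else 0) :=
            Finset.sum_le_sum_of_subset_of_nonneg (Finset.filter_subset _ _)
              fun j _ _ ↦ by split_ifs <;> linarith
        _ = ∑ j ∈ (Finset.range m).filter (fun j ↦ j < p), ℓ := by
            rw [Finset.sum_filter]
        _ = ℓ * ((Finset.range m).filter (fun j ↦ j < p)).card := by
            rw [Finset.sum_const, nsmul_eq_mul, mul_comm]
        _ ≤ ℓ * p := by
            have hc : (((Finset.range m).filter (fun j ↦ j < p)).card : ℝ) ≤ p := by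
              have h1 : ((Finset.range m).filter (fun j ↦ j < p)).card ≤ (Finset.range p).card :=
                Finset.card_le_card fun j hj ↦ by
                  simp only [Finset.mem_filter, Finset.mem_range] at hj ⊢; exact hj.2
              rw [Finset.card_range] at h1
              exact_mod_cast h1
            exact mul_le_mul_of_nonneg_left hc hℓ.le
    have h3 : ∑ j ∈ Pc, (2 * ℓ - (if j < p then ℓ else 0)) =
        2 * ℓ * Pc.card - ∑ j ∈ Pc, (if j < p then ℓ else 0) := by
      rw [Finset.sum_sub_distrib, Finset.sum_const, nsmul_eq_mul]; ring
    linarith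
  -- combine
  have htotal : 2 * ℓ * m - ℓ * p ≤ ∑ x ∈ F, w x := by
    have e : ∑ j ∈ P, (w (σ j) + w (τ j)) = ∑ j ∈ P, w (σ j) + ∑ j ∈ P, w (τ j) :=
      Finset.sum_add_distrib
    nlinarith [hstep1, hsplit, hcard, hpaired, hunpaired, e]
  calc (2 * (ψ b - ψ a) / π - ε / π - 4) * ℓ ≤ (2 * m - p) * ℓ := by
        apply mul_le_mul_of_nonneg_right _ hℓ.le
        have : V / π - 1 ≤ m := by linarith
        rw [← hV]
        have e2 : 2 * V / π = 2 * (V / π) := by ring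
        rw [e2]
        linarith
    _ = 2 * ℓ * m - ℓ * p := by ring
    _ ≤ ∑ x ∈ F, w x := htotal


/-! ### Backlund's trick -/

/-- Continuity of the horizontal logarithmic derivative `x ↦ h'/h (x+iy)` on a segment where `h` is
analytic and non-zero. [folklore] -/
lemma continuousOn_horizontal_logDeriv {h : ℂ → ℂ} {y u v : ℝ}
    (hh : ∀ x ∈ Icc u v, AnalyticAt ℂ h (x + y * I)) (h0 : ∀ x ∈ Icc u v, h (x + y * I) ≠ 0) :
    ContinuousOn (fun x : ℝ ↦ deriv h (x + y * I) / h (x + y * I)) (Icc u v) := by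
  intro x hx
  have han := hh x hx
  have hline : ContinuousAt (fun x : ℝ ↦ (x : ℂ) + y * I) x :=
    (Complex.continuous_ofReal.add continuous_const).continuousAt
  have h1 : ContinuousAt (fun x : ℝ ↦ deriv h (x + y * I)) x :=
    ContinuousAt.comp (f := fun x : ℝ ↦ (x : ℂ) + y * I) han.deriv.continuousAt hline
  have h2 : ContinuousAt (fun x : ℝ ↦ h (x + y * I)) x :=
    ContinuousAt.comp (f := fun x : ℝ ↦ (x : ℂ) + y * I) han.continuousAt hline
  exact (h1.div h2 (h0 x hx)).continuousWithinAt

set_option maxHeartbeats 1600000 in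
/-- **Backlund's trick** (Backlund 1918; [BMOR20, Prop. 5.4]; [HSW-Dedekind, Prop. 3.7];
[HasanalizadeShenWong2022, Prop. 3.2]). Let `g` be analytic on the disc `|z - (c+iy)| ≤ R` with
`g(c+iy) ≠ 0`, let `0 < ρ < R`, and put `σ₁ = c + ρ²/R`, `δ = ρ - ρ²/R`, `x₀ = c - ρ`. Suppose
`g ≠ 0` on `[x₀ - δ, σ₁] × {y}`, that a majorant `B ≥ 1` of `|g(z+iy)|`, `|g(z̄+iy)|` on `|z - c| = R`
has `circleAverage (log B) c R ≤ A`, and the **approximate reflection symmetry at `x₀`**: for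
`0 ≤ d ≤ δ`, `|Im ∫_{x₀}^{x₀+d} g'/g + Im ∫_{x₀}^{x₀-d} g'/g| ≤ ε` (for `ζ`, `x₀ = ½` and this is the
functional equation up to the variation `E` of the `Γ`-factor). Then
`|Im ∫_{x₀}^{σ₁} g'/g (x+iy) dx| ≤ π (A - log|g(c+iy)|) / (2 log(R/ρ)) + ε/2` —
half of Backlund's lemma `Literature.Analysis.Complex.abs_im_integral_logDeriv_le_of_circleAverage_le`:
every zero of `Re (e g)^N` on `(x₀, x₀+δ)` at `x₀ + d` beyond the first `O(Nε)` comes with a reflected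
zero in `[x₀ - d, x₀]`, and the pair weighs `log(R²/((ρ-d)(ρ+d'))) ≥ 2 log(R/ρ)` in Jensen's formula,
while zeros on `[x₀+δ, σ₁]` are within `ρ²/R` of the centre.
[cite: HasanalizadeShenWong2022, Prop. 3.2] -/
theorem abs_im_integral_logDeriv_le_backlundTrick {g : ℂ → ℂ} {B : ℂ → ℝ}
    {c y ρ R A ε : ℝ} (hρ : 0 < ρ) (hρR : ρ < R)
    (hg : ∀ z ∈ closedBall ((c : ℂ) + y * I) R, AnalyticAt ℂ g z) (hc : g (c + y * I) ≠ 0)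
    (hB : ∀ z ∈ sphere (c : ℂ) R, ‖g (z + y * I)‖ ≤ B z ∧ ‖g (conj z + y * I)‖ ≤ B z)
    (hB1 : ∀ z ∈ sphere (c : ℂ) R, 1 ≤ B z)
    (hBi : CircleIntegrable (fun z ↦ Real.log (B z)) c R)
    (hA : Real.circleAverage (fun z ↦ Real.log (B z)) c R ≤ A)
    (h0 : ∀ x ∈ Icc (c - ρ - (ρ - ρ ^ 2 / R)) (c + ρ ^ 2 / R), g (x + y * I) ≠ 0)
    (hε : 0 ≤ ε)
    (hrefl : ∀ d ∈ Icc (0 : ℝ) (ρ - ρ ^ 2 / R),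
      |(∫ x in (c - ρ)..(c - ρ + d), deriv g (x + y * I) / g (x + y * I)).im +
        (∫ x in (c - ρ)..(c - ρ - d), deriv g (x + y * I) / g (x + y * I)).im| ≤ ε) :
    |(∫ x in (c - ρ)..(c + ρ ^ 2 / R), deriv g (x + y * I) / g (x + y * I)).im| ≤
      π * (A - Real.log ‖g (c + y * I)‖) / (2 * Real.log (R / ρ)) + ε / 2 := by
  have hR : 0 < R := hρ.trans hρR
  have hπ := Real.pi_pos
  set ℓ := Real.log (R / ρ) with hℓ
  have hℓ0 : 0 < ℓ := Real.log_pos (by rw [one_lt_div hρ]; exact hρR)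
  -- geometry of the segment
  set a := c - ρ with ha
  set b := c + ρ ^ 2 / R with hb
  set δ := ρ - ρ ^ 2 / R with hδ
  have hρ2R : ρ ^ 2 / R < ρ := by
    rw [div_lt_iff₀ hR]; nlinarith
  have hρ2R0 : 0 < ρ ^ 2 / R := by positivity
  have hδ0 : 0 < δ := by rw [hδ]; linarith
  have hab : a ≤ b := by rw [ha, hb]; linarith
  set r' := (R + (2 * ρ - ρ ^ 2 / R)) / 2 with hr'
  have hkey : 2 * ρ - ρ ^ 2 / R < R := by
    have : 0 < (R - ρ) ^ 2 / R := by positivity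
    have e : (R - ρ) ^ 2 / R = R - 2 * ρ + ρ ^ 2 / R := by field_simp; ring
    linarith
  have hr'R : r' < R := by rw [hr']; linarith
  have hr'0 : 0 < r' := by rw [hr']; linarith
  have hr'1 : 2 * ρ - ρ ^ 2 / R < r' := by rw [hr']; linarith
  have hsegI : Icc (a - δ) b ⊆ Icc (c - r') (c + r') := by
    apply Icc_subset_Icc <;> [rw [ha, hδ]; rw [hb]] <;> linarith
  have hseg : ∀ x ∈ Icc (a - δ) b, (x : ℂ) + y * I ∈ closedBall ((c : ℂ) + y * I) R := by
    intro x hx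
    have h1 : (x : ℂ) ∈ closedBall (c : ℂ) R := by
      apply closedBall_subset_closedBall hr'R.le
      exact ofReal_mem_closedBall_of_mem_Icc (hsegI hx)
    exact (mem_closedBall_shift (y := y) h1).1
  have hcI : c ∈ Icc (a - δ) b := ⟨by rw [ha]; linarith, by rw [hb]; linarith⟩
  have haI : a ∈ Icc (a - δ) b := ⟨by linarith, hab⟩
  have hgI : ∀ x ∈ Icc (a - δ) b, AnalyticAt ℂ g (x + y * I) := fun x hx ↦ hg _ (hseg x hx)
  have h0I : ∀ x ∈ Icc (a - δ) b, g (x + y * I) ≠ 0 := fun x hx ↦ h0 x (by rwa [ha, hδ] at hx)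
  -- the rotation
  set w₀ := g (c + y * I) with hw₀
  have hw₀pos : 0 < ‖w₀‖ := norm_pos_iff.2 hc
  have hw₀n : (‖w₀‖ : ℂ) ≠ 0 := by exact_mod_cast hw₀pos.ne'
  set e : ℂ := conj w₀ / ‖w₀‖ with he
  have he1 : ‖e‖ = 1 := by
    rw [he, norm_div, Complex.norm_conj, Complex.norm_real, Real.norm_eq_abs, abs_norm,
      div_self hw₀pos.ne']
  have he0 : e ≠ 0 := norm_ne_zero_iff.1 (by rw [he1]; exact one_ne_zero)
  have hew : e * w₀ = (‖w₀‖ : ℂ) := by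
    rw [he, div_mul_eq_mul_div, Complex.conj_mul', pow_two, mul_div_assoc, div_self hw₀n, mul_one]
  set g₁ : ℂ → ℂ := fun z ↦ e * g z with hg₁
  -- the logarithmic derivative of `g` along the segment
  set fg : ℝ → ℂ := fun x ↦ deriv g (x + y * I) / g (x + y * I) with hfg
  have hfgc : ContinuousOn fg (Icc (a - δ) b) := continuousOn_horizontal_logDeriv hgI h0I
  have hfgi : ∀ p ∈ Icc (a - δ) b, ∀ q ∈ Icc (a - δ) b, IntervalIntegrable fg volume p q :=
    fun p hp q hq ↦ (hfgc.mono (uIcc_subset_Icc hp hq)).intervalIntegrable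
  set V := (∫ x in a..b, fg x).im with hV
  -- circle integrability of `log ‖G‖` for analytic `G`
  have hGint : ∀ {G : ℂ → ℂ}, AnalyticOnNhd ℂ G (closedBall (c : ℂ) R) →
      CircleIntegrable (fun z ↦ Real.log ‖G z‖) c R := by
    intro G hG
    have h1 : AnalyticOnNhd ℂ G (sphere (c : ℂ) |R|) := by
      rw [abs_of_pos hR]; exact hG.mono sphere_subset_closedBall
    exact h1.meromorphicOn.circleIntegrable_log_norm
  -- the bound for each `N ≥ 1`
  have key : ∀ N : ℕ, 0 < N →
      |V| ≤ π * (A - Real.log ‖w₀‖) / (2 * ℓ) + ε / 2 + 2 * π / N := by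
    intro N hN
    have hN0 : (0 : ℝ) < N := by exact_mod_cast hN
    set h : ℂ → ℂ := fun z ↦ (g₁ z) ^ N with hh
    have hhan : ∀ z ∈ closedBall ((c : ℂ) + y * I) R, AnalyticAt ℂ h z := fun z hz ↦
      (analyticAt_const.mul (hg z hz)).pow N
    have hhc : h (c + y * I) = ((‖w₀‖ ^ N : ℝ) : ℂ) := by
      simp only [hh, hg₁]
      rw [hew]; push_cast; rfl
    have hhre : (h (c + y * I)).re = ‖w₀‖ ^ N := by rw [hhc, Complex.ofReal_re]
    have hhim : (h (c + y * I)).im = 0 := by rw [hhc, Complex.ofReal_im]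
    have hhre0 : (h (c + y * I)).re ≠ 0 := by rw [hhre]; positivity
    have hhI : ∀ x ∈ Icc (a - δ) b, AnalyticAt ℂ h (x + y * I) := fun x hx ↦ hhan _ (hseg x hx)
    have hh0I : ∀ x ∈ Icc (a - δ) b, h (x + y * I) ≠ 0 := fun x hx ↦
      pow_ne_zero _ (mul_ne_zero he0 (h0I x hx))
    -- `h'/h = N g'/g` on the segment
    set fh : ℝ → ℂ := fun x ↦ deriv h (x + y * I) / h (x + y * I) with hfh
    have hid : ∀ x ∈ Icc (a - δ) b, fh x = (N : ℂ) * fg x := by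
      intro x hx
      have hd : DifferentiableAt ℂ g₁ (x + y * I) :=
        (analyticAt_const.mul (hgI x hx)).differentiableAt
      simp only [hfh, hfg]
      rw [show h = fun w ↦ g₁ w ^ N from rfl, deriv_pow_div_pow hd (mul_ne_zero he0 (h0I x hx)) N]
      congr 1
      exact deriv_const_mul_div_self e he0 _
    have hfhc : ContinuousOn fh (Icc (a - δ) b) := continuousOn_horizontal_logDeriv hhI hh0I
    have hint : ∀ p ∈ Icc (a - δ) b, ∀ q ∈ Icc (a - δ) b,
        (∫ x in p..q, fh x) = (N : ℂ) * ∫ x in p..q, fg x := by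
      intro p hp q hq
      rw [intervalIntegral.integral_congr (fun x hx ↦ hid x (uIcc_subset_Icc hp hq hx)),
        intervalIntegral.integral_const_mul]
    have himN : ∀ p ∈ Icc (a - δ) b, ∀ q ∈ Icc (a - δ) b,
        (∫ x in p..q, fh x).im = N * (∫ x in p..q, fg x).im := by
      intro p hp q hq
      rw [hint p hp q hq, show (N : ℂ) = ((N : ℝ) : ℂ) by norm_cast, Complex.im_ofReal_mul]
    -- the argument `ψ` along the segment
    set ψ : ℝ → ℝ := fun x ↦ (∫ s in a..x, fh s).im with hψ
    have hψc : ContinuousOn ψ (Icc (a - δ) b) := by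
      have hio : IntervalIntegrable fh volume (a - δ) b :=
        (hfhc.mono (by rw [uIcc_of_le (by linarith : a - δ ≤ b)])).intervalIntegrable
      have h1 := intervalIntegral.continuousOn_primitive_interval' (μ := volume) hio
        (by rw [uIcc_of_le (by linarith : a - δ ≤ b)]; exact haI)
      rw [uIcc_of_le (by linarith : a - δ ≤ b)] at h1
      exact Complex.continuous_im.comp_continuousOn h1
    have hψa : ψ a = 0 := by simp [hψ]
    have hψb : ψ b = N * V := by
      simp only [hψ, hV]; exact himN a haI b ⟨hab.trans' (by linarith), le_rfl⟩
    have hψrefl : ∀ d ∈ Icc (0 : ℝ) δ, |ψ (a + d) + ψ (a - d) - 2 * ψ a| ≤ N * ε := by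
      intro d hd
      have h1 : a + d ∈ Icc (a - δ) b := ⟨by linarith [hd.1], by rw [hb, ha]; linarith [hd.2]⟩
      have h2 : a - d ∈ Icc (a - δ) b := ⟨by linarith [hd.2], by linarith [hd.1]⟩
      have e1 : ψ (a + d) = N * (∫ x in a..(a + d), fg x).im := himN a haI _ h1
      have e2 : ψ (a - d) = N * (∫ x in a..(a - d), fg x).im := himN a haI _ h2
      rw [e1, e2, hψa, mul_zero, sub_zero, ← mul_add, abs_mul, abs_of_pos hN0]
      exact mul_le_mul_of_nonneg_left (hrefl d hd) hN0.le
    -- hits of the lattice `α + πℤ` are zeros of `Re h`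
    set α : ℝ := π / 2 - (∫ s in c..a, fh s).im with hα
    have hhit : ∀ x ∈ Icc (a - δ) b, (∃ k : ℤ, ψ x = α + k * π) → (h (x + y * I)).re = 0 := by
      rintro x hx ⟨k, hk⟩
      refine re_eq_zero_of_im_integral_logDeriv_eq hhI hh0I hcI hx hhim k ?_
      have hadd : (∫ s in c..x, fh s) = (∫ s in c..a, fh s) + ∫ s in a..x, fh s :=
        (intervalIntegral.integral_add_adjacent_intervals
          ((hfhc.mono (uIcc_subset_Icc hcI haI)).intervalIntegrable)
          ((hfhc.mono (uIcc_subset_Icc haI hx)).intervalIntegrable)).symm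
      rw [hadd, Complex.add_im]
      simp only [hψ] at hk
      rw [hk, hα]; ring
    -- the finite set of zeros of `Re h` on `[c - r', c + r']`
    have hfin := finite_zeros_re hr'0 hr'R hhan hhre0
    set F := hfin.toFinset with hF
    have hFmem : ∀ x ∈ F, x ∈ Icc (c - r') (c + r') ∧ (h (x + y * I)).re = 0 := fun x hx ↦ by
      rwa [hF, Set.Finite.mem_toFinset] at hx
    have hFhit : ∀ x ∈ Icc (a - δ) b, (∃ k : ℤ, ψ x = α + k * π) → x ∈ F := by
      intro x hx hk
      rw [hF, Set.Finite.mem_toFinset]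
      exact ⟨hsegI hx, hhit x hx hk⟩
    have hFc : ∀ x ∈ F, x ≠ c := by
      intro x hx hxc
      have := (hFmem x hx).2
      rw [hxc] at this
      exact hhre0 this
    -- the weights
    set wt : ℝ → ℝ := fun x ↦ Real.log (R / |x - c|) with hwt
    have hwt0 : ∀ x ∈ F, 0 ≤ wt x := by
      intro x hx
      have hxc : 0 < |x - c| := abs_pos.2 (sub_ne_zero.2 (hFc x hx))
      have h1 : |x - c| ≤ R := by
        have := (hFmem x hx).1
        rw [abs_le]; constructor <;> linarith [this.1, this.2]
      exact Real.log_nonneg ((one_le_div hxc).2 h1)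
    have hwt2 : ∀ x ∈ F, a + δ ≤ x → x ≤ b → 2 * ℓ ≤ wt x := by
      intro x hx h1 h2
      have hxc : 0 < |x - c| := abs_pos.2 (sub_ne_zero.2 (hFc x hx))
      have h3 : |x - c| ≤ ρ ^ 2 / R := by
        rw [ha, hδ] at h1; rw [hb] at h2
        rw [abs_le]; constructor <;> linarith
      have h4 : (R / ρ) ^ 2 ≤ R / |x - c| := by
        rw [div_pow, div_le_div_iff₀ (by positivity) hxc]
        calc R ^ 2 * |x - c| ≤ R ^ 2 * (ρ ^ 2 / R) := by gcongr
          _ = R * ρ ^ 2 := by field_simp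
      calc 2 * ℓ = Real.log ((R / ρ) ^ 2) := by rw [Real.log_pow]; push_cast; ring
        _ ≤ wt x := Real.log_le_log (by positivity) h4
    have hwt1 : ∀ x ∈ F, a < x → x < a + δ → ℓ ≤ wt x := by
      intro x _ h1 h2
      have h3 : |x - c| = c - x := by
        rw [abs_of_neg (by rw [ha, hδ] at h2; linarith)]; ring
      have hxc : 0 < c - x := by rw [ha, hδ] at h2; linarith
      have h4 : R / ρ ≤ R / |x - c| := by
        rw [h3]; apply div_le_div_of_nonneg_left hR.le hxc; rw [ha] at h1; linarith
      exact Real.log_le_log (by positivity) h4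
    have hwtp : ∀ x ∈ F, ∀ x' ∈ F, a < x → x < a + δ → 2 * a - x ≤ x' → x' ≤ a →
        2 * ℓ ≤ wt x + wt x' := by
      intro x _ x' _ h1 h2 h3 h4
      have hx1 : |x - c| = c - x := by
        rw [abs_of_neg (by rw [ha, hδ] at h2; linarith)]; ring
      have hx2 : |x' - c| = c - x' := by
        rw [abs_of_neg (by rw [ha] at h4; linarith)]; ring
      have hp1 : 0 < c - x := by rw [ha, hδ] at h2; linarith
      have hp2 : 0 < c - x' := by rw [ha] at h4; linarith
      -- `(c - x)(c - x') ≤ ρ²`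
      have hprod : (c - x) * (c - x') ≤ ρ ^ 2 := by
        set d := x - a with hd
        have e1 : c - x = ρ - d := by rw [hd, ha]; ring
        have e2 : c - x' ≤ ρ + d := by rw [hd, ha]; rw [ha] at h3; linarith
        have hd0 : 0 ≤ d := by rw [hd]; linarith
        have hdρ : d ≤ ρ := by rw [hd, ha]; rw [ha, hδ] at h2; linarith
        calc (c - x) * (c - x') ≤ (ρ - d) * (ρ + d) := by
              rw [e1]; exact mul_le_mul_of_nonneg_left e2 (by linarith)
          _ = ρ ^ 2 - d ^ 2 := by ring
          _ ≤ ρ ^ 2 := by nlinarith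
      have h5 : (R / ρ) ^ 2 ≤ R / |x - c| * (R / |x' - c|) := by
        rw [hx1, hx2, div_mul_div_comm, div_pow, div_le_div_iff₀ (by positivity) (by positivity)]
        calc R ^ 2 * ((c - x) * (c - x')) ≤ R ^ 2 * ρ ^ 2 := by gcongr
          _ = R * R * ρ ^ 2 := by ring
      calc 2 * ℓ = Real.log ((R / ρ) ^ 2) := by rw [Real.log_pow]; push_cast; ring
        _ ≤ Real.log (R / |x - c| * (R / |x' - c|)) := Real.log_le_log (by positivity) h5
        _ = wt x + wt x' := by
            rw [hwt]; exact Real.log_mul (by rw [hx1]; positivity) (by rw [hx2]; positivity)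
    -- Jensen (weighted) for `G = backlundAux h y`
    have hGan : AnalyticOnNhd ℂ (backlundAux h y) (closedBall (c : ℂ) R) := by
      intro z hz
      obtain ⟨hz1, hz2⟩ := mem_closedBall_shift (y := y) hz
      exact analyticAt_backlundAux (hhan _ hz1) (hhan _ hz2)
    have hGc : backlundAux h y c = ((‖w₀‖ ^ N : ℝ) : ℂ) := by
      rw [backlundAux_ofReal, hhre]
    have hGc0 : backlundAux h y c ≠ 0 := by
      rw [hGc, Complex.ofReal_ne_zero]; positivity
    have hGcn : Real.log ‖backlundAux h y c‖ = N * Real.log ‖w₀‖ := by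
      rw [hGc, Complex.norm_real, Real.norm_eq_abs, abs_of_pos (by positivity), Real.log_pow]
    have hptw : ∀ z ∈ sphere (c : ℂ) |R|,
        Real.log ‖backlundAux h y z‖ ≤ (N : ℝ) * Real.log (B z) := by
      intro z hz
      rw [abs_of_pos hR] at hz
      obtain ⟨hb1, hb2⟩ := hB z hz
      have hBz : 1 ≤ B z := hB1 z hz
      have hn1 : ‖h (z + y * I)‖ ≤ B z ^ N := by
        simp only [hh, hg₁, norm_pow, norm_mul, he1, one_mul]
        exact pow_le_pow_left₀ (norm_nonneg _) hb1 N
      have hn2 : ‖h (conj z + y * I)‖ ≤ B z ^ N := by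
        simp only [hh, hg₁, norm_pow, norm_mul, he1, one_mul]
        exact pow_le_pow_left₀ (norm_nonneg _) hb2 N
      have hGz : ‖backlundAux h y z‖ ≤ B z ^ N := by
        refine (norm_backlundAux_le h y z).trans ?_
        linarith
      rw [← Real.log_pow]
      rcases (norm_nonneg (backlundAux h y z)).eq_or_lt with h0' | hpos
      · rw [← h0', Real.log_zero]
        exact Real.log_nonneg (one_le_pow₀ hBz)
      · exact Real.log_le_log hpos hGz
    have hBiN : CircleIntegrable (fun z ↦ (N : ℝ) * Real.log (B z)) c R :=
      IntervalIntegrable.const_mul hBi (N : ℝ)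
    have hAN : Real.circleAverage (fun z ↦ Real.log ‖backlundAux h y z‖) c R ≤ N * A := by
      calc Real.circleAverage (fun z ↦ Real.log ‖backlundAux h y z‖) c R
          ≤ Real.circleAverage (fun z ↦ (N : ℝ) * Real.log (B z)) c R :=
            Real.circleAverage_mono (hGint hGan) hBiN hptw
        _ = N * Real.circleAverage (fun z ↦ Real.log (B z)) c R := by
            rw [← smul_eq_mul, ← Real.circleAverage_fun_smul]; rfl
        _ ≤ N * A := by gcongr
    have hJ : ∑ x ∈ F, wt x ≤ N * A - N * Real.log ‖w₀‖ := by
      have hFC : ∀ u ∈ F.image (fun x : ℝ ↦ (x : ℂ)), ‖u - c‖ < R ∧ backlundAux h y u = 0 := by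
        intro u hu
        rw [Finset.mem_image] at hu
        obtain ⟨x, hx, rfl⟩ := hu
        obtain ⟨hxI, hx0⟩ := hFmem x hx
        refine ⟨?_, (backlundAux_ofReal_eq_zero_iff h y x).2 hx0⟩
        rw [← Complex.ofReal_sub, Complex.norm_real, Real.norm_eq_abs, abs_lt]
        constructor <;> linarith [hxI.1, hxI.2]
      have h1 := sum_log_div_le_circleAverage_sub hR hGan hGc0 _ hFC
      have hinj : Set.InjOn (fun x : ℝ ↦ (x : ℂ)) F := fun x _ x' _ h ↦ Complex.ofReal_injective h
      rw [Finset.sum_image hinj] at h1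
      simp only [← Complex.ofReal_sub, Complex.norm_real, Real.norm_eq_abs] at h1
      rw [hGcn] at h1
      linarith
    -- the pairing count, for `ψ` and for `-ψ`
    have hNε : 0 ≤ (N : ℝ) * ε := by positivity
    have hP1 := backlund_pairing_sum_ge (ε := N * ε) (α := α) hab hδ0 hℓ0 hNε hψc hψrefl F hFhit
      hwt0 hwt2 hwt1 hwtp
    have hψrefl' : ∀ d ∈ Icc (0 : ℝ) δ, |-ψ (a + d) + -ψ (a - d) - 2 * -ψ a| ≤ N * ε := by
      intro d hd
      have h1 := hψrefl d hd
      have e1 : -ψ (a + d) + -ψ (a - d) - 2 * -ψ a = -(ψ (a + d) + ψ (a - d) - 2 * ψ a) := by ring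
      rw [e1, abs_neg]; exact h1
    have hFhit' : ∀ x ∈ Icc (a - δ) b, (∃ k : ℤ, -ψ x = -α + k * π) → x ∈ F := by
      rintro x hx ⟨k, hk⟩
      exact hFhit x hx ⟨-k, by push_cast; linarith⟩
    have hP2 := backlund_pairing_sum_ge (ψ := fun x ↦ -ψ x) (ε := N * ε) (α := -α) hab hδ0 hℓ0
      hNε hψc.neg hψrefl' F hFhit' hwt0 hwt2 hwt1 hwtp
    rw [hψa, hψb, sub_zero] at hP1
    simp only [hψa, hψb, neg_zero, sub_zero] at hP2
    -- `2 N |V| / π - N ε / π - 4 ≤ N (A - log ‖w₀‖) / ℓ`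
    set K := A - Real.log ‖w₀‖ with hK
    have hJK : ∑ x ∈ F, wt x ≤ N * K := by rw [hK]; linarith
    have hQ : (2 * (N * |V|) / π - N * ε / π - 4) * ℓ ≤ N * K := by
      rcases le_total 0 V with hv | hv
      · rw [abs_of_nonneg hv]; linarith
      · rw [abs_of_nonpos hv]
        have e1 : (2 * -(↑N * V) / π - ↑N * ε / π - 4) = (2 * (↑N * -V) / π - ↑N * ε / π - 4) := by
          ring
        rw [e1] at hP2
        linarith
    -- divide by `2Nℓ/π`
    have hQ1 : 2 * (N * |V|) / π - N * ε / π - 4 ≤ N * K / ℓ := by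
      rw [le_div_iff₀ hℓ0]; exact hQ
    have hQ2 : 2 * (N * |V|) ≤ (N * K / ℓ + N * ε / π + 4) * π := by
      rw [← div_le_iff₀ hπ]; linarith
    have e3 : (N * K / ℓ + N * ε / π + 4) * π = N * (π * K / ℓ) + N * ε + 4 * π := by
      have : N * ε / π * π = N * ε := div_mul_cancel₀ _ hπ.ne'
      rw [add_mul, add_mul, this]; ring
    rw [e3] at hQ2
    have hQ3 : (N : ℝ) * |V| ≤ N * (π * K / (2 * ℓ) + ε / 2 + 2 * π / N) := by
      have e4 : (N : ℝ) * (π * K / (2 * ℓ) + ε / 2 + 2 * π / N) =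
          (N * (π * K / ℓ) + N * ε + 4 * π) / 2 := by
        have : (N : ℝ) * (2 * π / N) = 2 * π := by field_simp
        rw [mul_add, mul_add, this]; ring
      rw [e4]; linarith
    exact le_of_mul_le_mul_left hQ3 hN0
  -- let `N → ∞`
  refine le_of_forall_pos_le_add fun η hη ↦ ?_
  obtain ⟨N, hN⟩ := exists_nat_gt (2 * π / η)
  have hNpos : (0 : ℝ) < N := lt_trans (div_pos (mul_pos two_pos hπ) hη) hN
  have hN' : 0 < N := by exact_mod_cast hNpos
  refine (key N hN').trans ?_
  have : 2 * π / N < η := by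
    rw [div_lt_iff₀ hNpos]
    rw [div_lt_iff₀ hη] at hN
    linarith
  linarith

end Literature.Analysis.Complex
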